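import Summits.CriticalPhenomena.PercolationContinuityZ3.Theorems.PercNearOneGluingNoHeavyLowerTailSahiThreeCopyCubeFour
import Summits.CriticalPhenomena.PercolationContinuityZ3.Theorems.PercNearOneGluingNoHeavyLowerTailSahiThreeCopyOneLevel

/-!
# `NoHeavyLowerTail` (crux stmt-CriticalPhenomena-4575), Sahi programme: **THE SLICE LAW (SC) AND THE PAIR-STEP LAW (PS) ARE FALSE** —
# an explicit counterexample on `{0,1}^5` (free slot = the path up-set `x₂x₃ ∨ x₁x₄ ∨ x₁x₂`), refuting the conjectures `SliceLaw`
# (`…SahiThreeCopySliceLaw`, gen 56) and `PairStepLaw` (`…SahiThreeCopyOneLevel`, gen 58); 3C-SAHI itself is NOT touched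

Support file (Sahi cell, seat `prim-sahi-p1`, generation 59; `--supports stmt-CriticalPhenomena-4575`).  One `decide`-style integer
evaluation (the thirteen three-copy counts of the witness, via the gen-55 bridge `pcoef3_tabZ_eq_N3`); standard axioms otherwise.

THE WITNESS (memo FROM-prim-sahi-p1-gen59 §5; found through the two-point/sandwich analysis: the full nested-pair two-point certificate
polytope is EMPTY for this free slot, kit j337191/j337661, and the emptiness certificate is a single ray that is realised ONE-POINT).
Dimension `d = 4`, profile `π = (1,1,1,1)`, all functions indicators of up-sets of `{0,1}^4` (coordinates `x₀,…,x₃`; bitmask tables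
`tabR 4 ·` of `…SahiC3CubeCertCheck`):
* free slot `f = 1_{P₄}`, `P₄ = x₁x₂ ∨ x₀x₃ ∨ x₀x₁` (the path `x₂–x₁–x₀–x₃`; mask `60104`),
* nested pairs `v = x₀x₃ ≤ g = x₃` (masks `43520 ≤ 65280`) and `w = x₁x₂ ≤ h = x₂` (masks `49344 ≤ 61680`).
Then the pair step `E_π(f,v,w | f,g,h) = scx π f v w f g h = −1 < 0` (`scx_witness_eq`), so `PairStepLaw` is false
(`not_pairStepLaw`), and since `SliceLaw → PairStepLaw` (`pairStepLaw_of_sliceLaw`, gen 58) the slice law is false too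
(`not_sliceLaw`).  In slice form: on `{0,1}^5` with the sliced coordinate `x₀'` glued in front, `F = P₄` (free of `x₀'`),
`G = x₃ ∧ (x₀' ∨ x₀)`, `H = x₂ ∧ (x₀' ∨ x₁)` have slices `(c₀,c₁,c₂,c₃) = (0,3,7,4)` at `π = (1,1,1,1)`: `c₂ = 7 < 8 = 2c₃` — the facet
`c₂ ≥ 2c₃` of the census's slice cone (exhaustive for `n ≤ 4`, CENSUS/W-SliceLaw) fails at `n = 5`; the other facet `c₁ + c₃ ≥ c₀ + c₂`
is tight (`7 = 7`) and all four slices are `≥ 0` (3C-SAHI holds for the witness).  Consequences: the route (SC) ⇒ (PS) ⇒ 3C-SAHI of memos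
gen56–58 is closed NEGATIVELY beyond the classes where it is a theorem (cumulation free slot: `sliceLaw_cumulation_free`; every free slot on
`≤ 3` coordinates: `…TwoPointCerts`); the two-point reduction for 3C-SAHI (`…TwoPoint`, which does not use (PS)) is unaffected. [this work]
-/

namespace Summit.CriticalPhenomena.PercolationContinuityZ3.Theorems.SahiThreeCopy

open Finset Function Literature.Combinatorics.Sahi2008
open Summit.CriticalPhenomena.PercolationContinuityZ3.Theorems.OneCutCert
open Summit.CriticalPhenomena.PercolationContinuityZ3.Theorems.CovTransferCert
open Summit.CriticalPhenomena.PercolationContinuityZ3.Theorems.SahiC3Cube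
open scoped BigOperators

/-! ### §1 The witness (bitmasks: `P₄ = 60104`, `x₀x₃ = 43520`, `x₃ = 65280`, `x₁x₂ = 49344`, `x₂ = 61680`; bit `Σ xᵢ2^i` per point) -/

/-- Tables are nonnegative. [this work] -/
theorem tabR_nonneg (m T : ℕ) (x : Pt m) : 0 ≤ tabR m T x := by
  unfold tabR; rw [tabZ_apply]; split_ifs <;> simp

/-- Pointwise comparison of two tables from the integer tables. [this work] -/
theorem tabR_le_of_tabZ {m A B : ℕ} (h : ∀ x : Pt m, tabZ m A x ≤ tabZ m B x) (x : Pt m) : tabR m A x ≤ tabR m B x := by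
  unfold tabR; exact_mod_cast h x

/-- Monotonicity of a table from the integer table. [this work] -/
theorem tabR_monotone_of_tabZ {m A : ℕ} (h : ∀ x y : Pt m, (∀ i, x i ≤ y i) → tabZ m A x ≤ tabZ m A y) : Monotone (tabR m A) := by
  intro x y hxy; unfold tabR; exact_mod_cast h x y (fun i => hxy i)

/-- ★ **The pair step of the witness is `−1`** (thirteen three-copy counts on `{0,1}^4`, evaluated on the integer tables by the kernel). [this work] -/
theorem scx_witness_eq :
    scx (fun _ : Fin 4 => (1 : ℕ)) (tabR 4 60104) (tabR 4 43520) (tabR 4 49344) (tabR 4 60104) (tabR 4 65280) (tabR 4 61680) = -1 := by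
  rw [show (fun _ : Fin 4 => (1 : ℕ)) = (fun i => (((fun _ => 1 : Fin 4 → Fin 4) i : Fin 4) : ℕ)) from rfl]
  unfold scx
  simp only [← tabR_land_mul, ← tabR_fullN_eq_one 4, ← pcoef3_tabZ_eq_N3]
  norm_cast

/-! ### §2 The refutations -/

/-- ★★ **The pair-step law (PS) is FALSE**: `E_π(f,v,w|f,g,h) = −1 < 0` for the witness `f = 1_{P₄}`, `v = x₀x₃ ≤ g = x₃`,
`w = x₁x₂ ≤ h = x₂` at `π = (1,1,1,1)`. [this work] -/
theorem not_pairStepLaw : ¬ PairStepLaw := by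
  intro hPS
  have h := hPS 4 (fun _ : Fin 4 => (1 : ℕ)) (tabR 4 43520) (tabR 4 49344) (tabR 4 60104) (tabR 4 65280) (tabR 4 61680)
    (tabR_nonneg 4 _) (tabR_nonneg 4 _) (tabR_nonneg 4 _)
    (tabR_le_of_tabZ (by decide)) (tabR_le_of_tabZ (by decide))
    (tabR_monotone_of_tabZ (by decide)) (tabR_monotone_of_tabZ (by decide)) (tabR_monotone_of_tabZ (by decide))
    (tabR_monotone_of_tabZ (by decide)) (tabR_monotone_of_tabZ (by decide))
  rw [scx_witness_eq] at h
  norm_num at h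

/-- ★★ **The slice law (SC) is FALSE** (since `SliceLaw → PairStepLaw`, `pairStepLaw_of_sliceLaw`). [this work] -/
theorem not_sliceLaw : ¬ SliceLaw := fun h => not_pairStepLaw (pairStepLaw_of_sliceLaw h)

end Summit.CriticalPhenomena.PercolationContinuityZ3.Theorems.SahiThreeCopy
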